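import Summits.KontsevichZagierPeriods.KontsevichZagierPeriods.Theorems.LinRedNormalFormArrangementNormalFormSeparateThreeHILetters
import Summits.KontsevichZagierPeriods.KontsevichZagierPeriods.Theorems.LinRedNormalFormArrangementNormalFormSeparateThreeHIPoly

/-!
# The lower power bound at a vertex: absolute convergence forces the exponent inequality

(Line `janus-bands`, crux `ArrangementNormalForm`, stub `stub_separateThreeZero`, part `HILower` of
the termwise numerator split `separateThree_hI` under the rim condition.)

`exponent_lt3` (registered as `separateThree_lower`): if the integrand
`Fform = (∑ Qᵢ w^i)/Wt · w^{-n}` is absolutely integrable on the open cell `Ω` lying above the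
pole plane, `(v₀, 0)` is adherent to `Ω`, the numerator has Taylor data `c` of order `ord c` at
`(v₀, 0)` and the letter block has order `E` at `v₀` (no active letter through `v₀` being
identically zero), then `n + E < ord c + 3`. Proof: a small cube `S₁` inside `Ω` near `(v₀, 0)`,
off the planes of the letters through `v₀` (`exists_transversal_point`), whose dyadic dilates
`2^{-k} S₁` are pairwise disjoint and stay in `Ω` (local cone); on `2^{-k} S₁` the numerator is
bounded below in `L¹` by `2^{-k(3 + ord c)}` times a constant (dilation `setIntegral_dilate` and norm
equivalence `exists_coeff_le_lone3`) while `|Wt| w^n ≤ C 2^{-k(n+E)}`; if `n + E ≥ ord c + 3` the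
integrals of `|Fform|` over the disjoint dilates are bounded below, contradicting integrability.
-/

noncomputable section

open Set MeasureTheory Filter Topology
open scoped ENNReal Pointwise

namespace Summit.KontsevichZagierPeriods.ArrangementNormalForm.JanusBands

namespace SepThree

section Lower

variable {J m : ℕ} (g : Fin J → Con) (κ : Fin m → Fin 2 → ℝ) (μ : Fin m → ℝ) (e : Fin m → ℕ)
  (N : ℕ) (q : ℕ → MvPolynomial (Fin 2) ℝ) (n : ℕ) (v₀ : Fin 2 → ℝ)

set_option maxHeartbeats 1600000 in
/-- **The exponent inequality.** See the module docstring. -/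
theorem exponent_lt3 (hcl : ((v₀, 0) : (Fin 2 → ℝ) × ℝ) ∈ closure (Om3 g))
    (hpos : ∀ p ∈ Om3 g, 0 < p.2) (hint : IntegrableOn (Fform κ μ e N q n) (Om3 g))
    (hnd : ∀ j, lval κ μ j v₀ = 0 → e j ≠ 0 → κ j ≠ 0)
    {d : ℕ} (hNd : N ≤ d + 1) (c : Coef d)
    (hc : ∀ (i : ℕ) (hi : i < N) (u : Fin 2 → ℝ),
      MvPolynomial.eval (v₀ + u) (q i) = SepTwo.pev₂ (c ⟨i, lt_of_lt_of_le hi hNd⟩) (u 0) (u 1))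
    (hc0 : ∀ i : Fin (d + 1), N ≤ (i : ℕ) → c i = 0) (h : (nz c).Nonempty) :
    n + Eord κ μ e v₀ < ord c h + 3 := by
  classical
  by_contra hge
  push Not at hge
  -- radii: local cone, letter block bounds
  have h0 := cval_nonneg_of_mem_closure g hcl
  obtain ⟨r₀, hr₀, hiff⟩ := mem_Om3_iff_act g v₀ h0
  obtain ⟨CW, hCW, hWup⟩ := Wt_upper κ μ e v₀
  obtain ⟨δW, hδW, hWunif⟩ := Wt_lower_unif κ μ e v₀
  -- the bad letters and a transversal point of the cell near `(v₀, 0)`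
  set B : Finset (Fin m) := Finset.univ.filter fun j => lval κ μ j v₀ = 0 ∧ e j ≠ 0 with hB
  have hBκ : ∀ j ∈ B, κ j ≠ 0 := fun j hj => by
    obtain ⟨h1, h2⟩ := (Finset.mem_filter.1 hj).2
    exact hnd j h1 h2
  set r' : ℝ := min (min r₀ 1) δW / 4 with hr'
  have hr'0 : 0 < r' := by positivity
  obtain ⟨ps, hps, hdist⟩ := Metric.mem_closure_iff.1 hcl (r' / 2) (half_pos hr'0)
  -- translated coordinates centred at `(v₀, 0)`
  set U₀ : Set ((Fin 2 → ℝ) × ℝ) := {p | (v₀, 0) + p ∈ Om3 g} with hU₀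
  have hU₀o : IsOpen U₀ := (isOpen_Om3 g).preimage (by fun_prop)
  have hps₀ : ps - (v₀, 0) ∈ U₀ := by
    show (v₀, 0) + (ps - (v₀, 0)) ∈ Om3 g
    rw [add_sub_cancel]; exact hps
  obtain ⟨qs, hqs_mem, hqsd, htr'⟩ := exists_transversal_point κ B hBκ hU₀o hps₀ (half_pos hr'0)
  have hqs_Om : (v₀, 0) + qs ∈ Om3 g := hqs_mem
  have hqs_norm : ‖qs‖ < r' := by
    have h2 : ‖ps - (v₀, 0)‖ < r' / 2 := by rw [← dist_eq_norm, dist_comm]; exact hdist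
    calc ‖qs‖ = ‖(qs - (ps - (v₀, 0))) + (ps - (v₀, 0))‖ := by rw [sub_add_cancel]
      _ ≤ ‖qs - (ps - (v₀, 0))‖ + ‖ps - (v₀, 0)‖ := norm_add_le _ _
      _ < r' := by linarith
  have hτ : 0 < qs.2 := by
    have := hpos _ hqs_Om
    rwa [Prod.snd_add, zero_add] at this
  have hqs_act : ∀ j ∈ act g v₀, 0 < clin (g j) qs := by
    have hn : ‖qs‖ < r₀ := hqs_norm.trans_le (by
      rw [hr']
      linarith [min_le_left (min r₀ 1) δW, min_le_left r₀ 1, le_min (le_min hr₀.le zero_le_one) hδW.le])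
    exact (hiff qs hn).1 hqs_Om
  -- transversality constant and the lower letter bound
  obtain ⟨ctr, hctr0, hctr⟩ : ∃ ctr > 0, ∀ j ∈ B, ctr ≤ |κ j 0 * qs.1 0 + κ j 1 * qs.1 1| / 2 := by
    obtain ⟨ctr, h1, h2⟩ := exists_pos_le_all
      (fun j : Fin m => if j ∈ B then |κ j 0 * qs.1 0 + κ j 1 * qs.1 1| / 2 else 1) (fun j => by
        split_ifs with hj
        · exact half_pos (abs_pos.2 (htr' j hj))
        · exact one_pos)
    exact ⟨ctr, h1, fun j hj => by have := h2 j; rwa [if_pos hj] at this⟩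
  obtain ⟨cW, hcW, hWlo⟩ := hWunif (ctr / (‖qs‖ + 1)) (by positivity)
  -- the half-width of the cube
  set Lc : Fin J → ℝ := fun j => |(g j).1 0| + |(g j).1 1| + |(g j).2.1| + 1 with hLc
  have hLc0 : ∀ j, 0 < Lc j := fun j => by simp only [hLc]; positivity
  set Kk : Fin m → ℝ := fun j => |κ j 0| + |κ j 1| + 1 with hKk
  have hKk0 : ∀ j, 0 < Kk j := fun j => by simp only [hKk]; positivity
  obtain ⟨ηa, hηa0, hηa⟩ := exists_pos_le_all
    (fun j : Fin J => if j ∈ act g v₀ then clin (g j) qs / Lc j else 1) (fun j => by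
      split_ifs with hj
      · exact div_pos (hqs_act j hj) (hLc0 j)
      · exact one_pos)
  obtain ⟨ηb, hηb0, hηb⟩ := exists_pos_le_all
    (fun j : Fin m => if j ∈ B then |κ j 0 * qs.1 0 + κ j 1 * qs.1 1| / (2 * Kk j) else 1) (fun j => by
      split_ifs with hj
      · exact div_pos (abs_pos.2 (htr' j hj)) (by linarith [hKk0 j])
      · exact one_pos)
  set η : ℝ := min (min (ηa / 2) (ηb / 2)) (min (qs.2 / 4) ((r' - ‖qs‖) / 2)) with hη
  have hη0 : 0 < η := by
    simp only [hη, lt_min_iff]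
    exact ⟨⟨by linarith, by linarith⟩, by linarith, by linarith⟩
  have hηa' : η < ηa := by
    have : η ≤ ηa / 2 := (min_le_left _ _).trans (min_le_left _ _); linarith
  have hηb' : η < ηb := by
    have : η ≤ ηb / 2 := (min_le_left _ _).trans (min_le_right _ _); linarith
  have hητ : η ≤ qs.2 / 4 := (min_le_right _ _).trans (min_le_left _ _)
  have hηr : ‖qs‖ + η < r' := by
    have : η ≤ (r' - ‖qs‖) / 2 := (min_le_right _ _).trans (min_le_right _ _)
    linarith
  -- the cube `S₁` and the facts on it
  set S₁ := cube qs η with hS₁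
  have hS₁norm : ∀ p ∈ S₁, ‖p - qs‖ ≤ η := fun p hp => norm_sub_le_of_mem_cube hη0.le hp
  have hS₁bd : ∀ p ∈ S₁, ‖p‖ < r' := fun p hp => by
    calc ‖p‖ = ‖(p - qs) + qs‖ := by rw [sub_add_cancel]
      _ ≤ ‖p - qs‖ + ‖qs‖ := norm_add_le _ _
      _ < r' := by linarith [hS₁norm p hp]
  have hmin3 : min (min r₀ 1) δW ≤ r₀ ∧ min (min r₀ 1) δW ≤ 1 ∧ min (min r₀ 1) δW ≤ δW :=
    ⟨(min_le_left _ _).trans (min_le_left _ _), (min_le_left _ _).trans (min_le_right _ _), min_le_right _ _⟩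
  have hmin0 : 0 ≤ min (min r₀ 1) δW := le_min (le_min hr₀.le zero_le_one) hδW.le
  have hr'1 : r' ≤ 1 / 4 := by rw [hr']; linarith [hmin3.2.1]
  have hr'r₀ : r' ≤ r₀ := by rw [hr']; linarith [hmin3.1]
  have hr'W : r' ≤ δW / 4 := by rw [hr']; linarith [hmin3.2.2]
  have hS₁act : ∀ p ∈ S₁, ∀ j ∈ act g v₀, 0 < clin (g j) p := fun p hp j hj => by
    have hd := abs_clin_le (g j) (p - qs)
    rw [show clin (g j) (p - qs) = clin (g j) p - clin (g j) qs by
      rw [sub_eq_add_neg, clin_add, show -qs = (-1 : ℝ) • qs by simp, clin_smul]; ring] at hd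
    have hηj : η < clin (g j) qs / Lc j := by
      have := hηa j; rw [if_pos hj] at this; exact hηa'.trans_le this
    have h1 : (|(g j).1 0| + |(g j).1 1| + |(g j).2.1|) * ‖p - qs‖ ≤ Lc j * η :=
      mul_le_mul (by simp only [hLc]; linarith) (hS₁norm p hp) (norm_nonneg _) (hLc0 j).le
    have h2 : Lc j * η < clin (g j) qs := by
      have h5 := mul_lt_mul_of_pos_left hηj (hLc0 j)
      have hLj := (hLc0 j).ne'
      have h6 : Lc j * (clin (g j) qs / Lc j) = clin (g j) qs := by field_simp
      linarith
    rw [abs_le] at hd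
    linarith [hd.1]
  have hS₁tr : ∀ p ∈ S₁, ∀ j ∈ B, |κ j 0 * qs.1 0 + κ j 1 * qs.1 1| / 2 ≤ |κ j 0 * p.1 0 + κ j 1 * p.1 1| :=
    fun p hp j hj => by
    have hd := abs_klin_le κ j (p.1 - qs.1)
    have hpq : ‖p.1 - qs.1‖ ≤ η := (norm_fst_le (p - qs)).trans (hS₁norm p hp)
    have hηj : η < |κ j 0 * qs.1 0 + κ j 1 * qs.1 1| / (2 * Kk j) := by
      have := hηb j; rw [if_pos hj] at this; exact hηb'.trans_le this
    have h1 : (|κ j 0| + |κ j 1|) * ‖p.1 - qs.1‖ ≤ Kk j * η :=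
      mul_le_mul (by simp only [hKk]; linarith) hpq (norm_nonneg _) (hKk0 j).le
    have h2 : Kk j * η < |κ j 0 * qs.1 0 + κ j 1 * qs.1 1| / 2 := by
      have h5 := mul_lt_mul_of_pos_left hηj (hKk0 j)
      have hKj := (hKk0 j).ne'
      have h6 : Kk j * (|κ j 0 * qs.1 0 + κ j 1 * qs.1 1| / (2 * Kk j)) =
          |κ j 0 * qs.1 0 + κ j 1 * qs.1 1| / 2 := by
        field_simp
      linarith
    have e1 : κ j 0 * (p.1 - qs.1) 0 + κ j 1 * (p.1 - qs.1) 1 =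
        (κ j 0 * p.1 0 + κ j 1 * p.1 1) - (κ j 0 * qs.1 0 + κ j 1 * qs.1 1) := by
      simp only [Pi.sub_apply]; ring
    rw [e1] at hd
    have := abs_sub_abs_le_abs_sub (κ j 0 * qs.1 0 + κ j 1 * qs.1 1) (κ j 0 * p.1 0 + κ j 1 * p.1 1)
    rw [abs_sub_comm] at this
    linarith
  have hS₁t : ∀ p ∈ S₁, 3 * qs.2 / 4 ≤ p.2 ∧ p.2 ≤ 5 * qs.2 / 4 := fun p hp => by
    have := (mem_cube_iff.1 hp).2
    rw [abs_le] at this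
    constructor <;> linarith
  -- dilates of the cube: inside the cell, letter block and weight bounds
  set R₁ : ℝ := ‖qs‖ + η with hR₁
  have hR₁0 : 0 < R₁ := by positivity
  have hdil_mem : ∀ (s : ℝ), 0 < s → s ≤ 1 → ∀ p ∈ S₁, (v₀, 0) + s • p ∈ Om3 g := by
    intro s hs hs1 p hp
    have hnorm : ‖s • p‖ < r₀ := by
      rw [norm_smul, Real.norm_eq_abs, abs_of_pos hs]
      calc s * ‖p‖ ≤ 1 * ‖p‖ := mul_le_mul_of_nonneg_right hs1 (norm_nonneg _)
        _ < r₀ := by rw [one_mul]; exact (hS₁bd p hp).trans_le hr'r₀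
    refine (hiff (s • p) hnorm).2 fun j hj => ?_
    rw [clin_smul]
    exact mul_pos hs (hS₁act p hp j hj)
  have hdil_W : ∀ (s : ℝ), 0 < s → s ≤ 1 → ∀ p ∈ S₁,
      0 < |Wt κ μ e (v₀ + (s • p).1)| ∧ |Wt κ μ e (v₀ + (s • p).1)| ≤ CW * (s * R₁) ^ Eord κ μ e v₀ := by
    intro s hs hs1 p hp
    have hu : ‖(s • p).1‖ ≤ s * R₁ := by
      rw [Prod.smul_fst, norm_smul, Real.norm_eq_abs, abs_of_pos hs]
      refine mul_le_mul_of_nonneg_left ?_ hs.le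
      calc ‖p.1‖ ≤ ‖p‖ := norm_fst_le p
        _ = ‖(p - qs) + qs‖ := by rw [sub_add_cancel]
        _ ≤ ‖p - qs‖ + ‖qs‖ := norm_add_le _ _
        _ ≤ R₁ := by rw [hR₁]; linarith [hS₁norm p hp]
    have hu1 : ‖(s • p).1‖ ≤ 1 := hu.trans (by
      calc s * R₁ ≤ 1 * R₁ := mul_le_mul_of_nonneg_right hs1 hR₁0.le
        _ ≤ 1 := by rw [one_mul]; linarith [hηr, hr'1, hR₁])
    have huW : ‖(s • p).1‖ < δW := hu.trans_lt (by
      calc s * R₁ ≤ 1 * R₁ := mul_le_mul_of_nonneg_right hs1 hR₁0.le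
        _ < δW := by rw [one_mul]; linarith [hηr, hr'W, hR₁, hδW])
    refine ⟨?_, (hWup _ hu1).trans (mul_le_mul_of_nonneg_left
      (pow_le_pow_left₀ (norm_nonneg _) hu _) hCW.le)⟩
    -- positivity from the lower letter bound on transversal displacements
    have htrs : ∀ j, lval κ μ j v₀ = 0 → e j ≠ 0 →
        ctr / (‖qs‖ + 1) * ‖(s • p).1‖ ≤ |κ j 0 * (s • p).1 0 + κ j 1 * (s • p).1 1| := by
      intro j hj hej
      have hjB : j ∈ B := Finset.mem_filter.2 ⟨Finset.mem_univ _, hj, hej⟩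
      rw [Prod.smul_fst, klin_smul, abs_mul, abs_of_pos hs, norm_smul, Real.norm_eq_abs, abs_of_pos hs]
      have h1 := hS₁tr p hp j hjB
      have h2 := hctr j hjB
      have h3 : ‖p.1‖ ≤ ‖qs‖ + 1 := by
        calc ‖p.1‖ ≤ ‖p‖ := norm_fst_le p
          _ = ‖(p - qs) + qs‖ := by rw [sub_add_cancel]
          _ ≤ ‖p - qs‖ + ‖qs‖ := norm_add_le _ _
          _ ≤ ‖qs‖ + 1 := by linarith [hS₁norm p hp, hηr, hr'1, hR₁, norm_nonneg qs]
      calc ctr / (‖qs‖ + 1) * (s * ‖p.1‖) = s * (ctr * (‖p.1‖ / (‖qs‖ + 1))) := by ring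
        _ ≤ s * (ctr * 1) := by
            refine mul_le_mul_of_nonneg_left (mul_le_mul_of_nonneg_left ?_ hctr0.le) hs.le
            exact (div_le_one (by positivity)).2 h3
        _ ≤ s * |κ j 0 * p.1 0 + κ j 1 * p.1 1| := by
            refine mul_le_mul_of_nonneg_left ?_ hs.le
            rw [mul_one]; exact h2.trans h1
    have hlow := hWlo _ huW htrs
    refine lt_of_lt_of_le ?_ hlow
    by_cases hE : Eord κ μ e v₀ = 0
    · rw [hE, pow_zero, mul_one]; exact hcW
    · obtain ⟨j, hj, hej⟩ := Finset.exists_ne_zero_of_sum_ne_zero hE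
      have hjv : lval κ μ j v₀ = 0 := (Finset.mem_filter.1 hj).2
      have hne : (s • p).1 ≠ 0 := by
        intro h0
        have := htrs j hjv hej
        rw [h0] at this
        simp only [Pi.zero_apply, mul_zero, add_zero, abs_zero, norm_zero] at this
        have hjB : j ∈ B := Finset.mem_filter.2 ⟨Finset.mem_univ _, hjv, hej⟩
        have h1 := hS₁tr p hp j hjB
        have h2 : 0 < |κ j 0 * qs.1 0 + κ j 1 * qs.1 1| / 2 := half_pos (abs_pos.2 (htr' j hjB))
        -- `p.1 = 0` forces the transversal quantity to vanish
        have hp0 : p.1 = 0 := by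
          have := congrArg (fun v : Fin 2 → ℝ => s⁻¹ • v) h0
          simpa [Prod.smul_fst, smul_smul, inv_mul_cancel₀ hs.ne'] using this
        rw [hp0] at h1
        simp only [Pi.zero_apply, mul_zero, add_zero, abs_zero] at h1
        linarith
      exact mul_pos hcW (pow_pos (norm_pos_iff.2 hne) _)
  -- the numerator and the integrand on the dilates
  set G : (Fin 2 → ℝ) × ℝ → ℝ := fun p => Fform κ μ e N q n ((v₀, 0) + p) with hG
  have hGint : IntegrableOn G {p | (v₀, 0) + p ∈ Om3 g} := integrableOn_translate hint (v₀, 0)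
  set C₁ : ℝ := CW * R₁ ^ Eord κ μ e v₀ * (5 * qs.2 / 4) ^ n with hC₁
  have hC₁0 : 0 < C₁ := by positivity
  have hkey : ∀ (s : ℝ), 0 < s → s ≤ 1 → ∀ p ∈ S₁,
      |pev3 c (s • p)| ≤ C₁ * s ^ (n + Eord κ μ e v₀) * |G (s • p)| := by
    intro s hs hs1 p hp
    obtain ⟨hWpos, hWle⟩ := hdil_W s hs hs1 p hp
    obtain ⟨ht1, ht2⟩ := hS₁t p hp
    have hsp2 : (s • p).2 = s * p.2 := rfl
    have htpos : 0 < (s • p).2 := by rw [hsp2]; exact mul_pos hs (by linarith)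
    have hP : pev3 c (s • p) = G (s • p) * Wt κ μ e (v₀ + (s • p).1) * (s • p).2 ^ n := by
      have hF : G (s • p) = psum N (fun i => Qv q i (v₀ + (s • p).1)) (s • p).2 /
          Wt κ μ e (v₀ + (s • p).1) * (1 / (s • p).2) ^ n := by
        simp only [hG, Fform, Prod.fst_add, Prod.snd_add, zero_add]
      have hps : psum N (fun i => Qv q i (v₀ + (s • p).1)) (s • p).2 = pev3 c (s • p) := by
        have := psum_eq_pev3 hNd hc hc0 (s • p).1 (s • p).2
        simpa only [Qv] using this
      rw [hF, hps]
      have hW0 : Wt κ μ e (v₀ + (s • p).1) ≠ 0 := abs_pos.1 hWpos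
      have ht0 : (s • p).2 ≠ 0 := htpos.ne'
      have hcancel : (1 / (s • p).2) ^ n * (s • p).2 ^ n = 1 := by
        rw [← mul_pow, one_div_mul_cancel ht0, one_pow]
      calc pev3 c (s • p) = pev3 c (s • p) * (Wt κ μ e (v₀ + (s • p).1) / Wt κ μ e (v₀ + (s • p).1)) *
            ((1 / (s • p).2) ^ n * (s • p).2 ^ n) := by rw [div_self hW0, hcancel]; ring
        _ = _ := by ring
    rw [hP, abs_mul, abs_mul, abs_pow, abs_of_pos htpos]
    have htle : (s • p).2 ^ n ≤ (s * (5 * qs.2 / 4)) ^ n := by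
      refine pow_le_pow_left₀ htpos.le ?_ _
      rw [hsp2]; exact mul_le_mul_of_nonneg_left ht2 hs.le
    calc |G (s • p)| * |Wt κ μ e (v₀ + (s • p).1)| * (s • p).2 ^ n
        ≤ |G (s • p)| * (CW * (s * R₁) ^ Eord κ μ e v₀) * (s * (5 * qs.2 / 4)) ^ n := by
          gcongr
      _ = C₁ * s ^ (n + Eord κ μ e v₀) * |G (s • p)| := by
          simp only [hC₁]; rw [mul_pow, mul_pow, pow_add]; ring
  -- the coefficient of order `ord c` and norm equivalence on the cube
  obtain ⟨i₀, j₀, k₀, hc₀, hdeg⟩ := exists_tdeg_eq_ord h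
  have hl : ∀ i, (qs - ((fun _ => η), η)).1 i < (qs + ((fun _ => η), η)).1 i := fun i => by
    simp only [Prod.fst_sub, Prod.fst_add, Pi.sub_apply, Pi.add_apply]; linarith
  have hl2 : (qs - ((fun _ => η), η)).2 < (qs + ((fun _ => η), η)).2 := by
    simp only [Prod.snd_sub, Prod.snd_add]; linarith
  obtain ⟨Cn, hCn, hne⟩ := exists_coeff_le_lone3 d hl hl2
  -- the lower bound on each dilate
  set κ₀ : ℝ := |c i₀ j₀ k₀| / (Cn * C₁) with hκ₀
  have hκ₀0 : 0 < κ₀ := by simp only [hκ₀]; exact div_pos (abs_pos.2 hc₀) (mul_pos hCn hC₁0)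
  have hGintS : ∀ (s : ℝ), 0 < s → s ≤ 1 → IntegrableOn G (s • S₁) := fun s hs hs1 =>
    hGint.mono_set (by
      rintro p ⟨p₁, hp₁, rfl⟩
      exact hdil_mem s hs hs1 p₁ hp₁)
  have hbox : ∀ (s : ℝ), 0 < s → s ≤ 1 → κ₀ ≤ ∫ p in s • S₁, |G p| := by
    intro s hs hs1
    -- `∫_{sS₁} |pev3 c| = s³ ∫_{S₁} |pev3 (dilate s c)| ≥ s³ |c₀| s^{ord} / Cn`
    have hscale : ∫ p in s • S₁, |pev3 c p| = s ^ 3 * lone3 (qs - ((fun _ => η), η))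
        (qs + ((fun _ => η), η)) (dilate s c) := by
      rw [setIntegral_dilate S₁ (fun p => |pev3 c p|) hs]
      simp only [pev3_dilate]
      rfl
    have hlow1 : s ^ 3 * (|c i₀ j₀ k₀| * s ^ ord c h / Cn) ≤ ∫ p in s • S₁, |pev3 c p| := by
      rw [hscale]
      refine mul_le_mul_of_nonneg_left ?_ (by positivity)
      rw [div_le_iff₀ hCn]
      have := hne (dilate s c) i₀ j₀ k₀
      rw [dilate_apply, abs_mul, abs_pow, abs_of_pos hs, hdeg] at this
      linarith
    -- `∫_{sS₁} |pev3 c| ≤ C₁ s^{n+E} ∫_{sS₁} |G|`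
    have hupp : ∫ p in s • S₁, |pev3 c p| ≤ C₁ * s ^ (n + Eord κ μ e v₀) * ∫ p in s • S₁, |G p| := by
      rw [← integral_const_mul]
      refine setIntegral_mono_on ((continuous_pev3 c).abs.continuousOn.integrableOn_compact
        ((isCompact_cube qs η).smul s)) ((hGintS s hs hs1).abs.const_mul _)
        ((measurableSet_cube qs η).const_smul₀ s) ?_
      rintro p ⟨p₁, hp₁, rfl⟩
      exact hkey s hs hs1 p₁ hp₁
    -- compare the powers of `s`
    have hspow : s ^ (n + Eord κ μ e v₀) ≤ s ^ (ord c h + 3) := pow_le_pow_of_le_one hs.le hs1 hge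
    have hI0 : 0 ≤ ∫ p in s • S₁, |G p| := integral_nonneg fun _ => abs_nonneg _
    have h3 : s ^ 3 * (|c i₀ j₀ k₀| * s ^ ord c h / Cn) ≤ C₁ * s ^ (ord c h + 3) * ∫ p in s • S₁, |G p| :=
      hlow1.trans (hupp.trans (mul_le_mul_of_nonneg_right
        (mul_le_mul_of_nonneg_left hspow hC₁0.le) hI0))
    have hs3 : 0 < s ^ (ord c h + 3) := pow_pos hs _
    rw [show s ^ 3 * (|c i₀ j₀ k₀| * s ^ ord c h / Cn) = s ^ (ord c h + 3) * (|c i₀ j₀ k₀| / Cn) by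
      rw [pow_add]; ring] at h3
    have h4 : |c i₀ j₀ k₀| / Cn ≤ C₁ * ∫ p in s • S₁, |G p| := by
      have := h3
      rw [show C₁ * s ^ (ord c h + 3) * ∫ p in s • S₁, |G p| =
        s ^ (ord c h + 3) * (C₁ * ∫ p in s • S₁, |G p|) by ring] at this
      exact le_of_mul_le_mul_left this hs3
    rw [hκ₀, div_le_iff₀ (mul_pos hCn hC₁0)]
    rw [div_le_iff₀ hCn] at h4
    nlinarith
  -- the dyadic dilates argument
  exact false_of_dilates_lower_bound (measurableSet_cube qs η) hτ hS₁t hGint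
    (fun s hs hs1 p hp => hdil_mem s hs hs1 p hp) hκ₀0 hbox

end Lower

end SepThree

/-- **The exponent inequality at a vertex** (registered part of `stub_separateThreeZero`; literal
form of `SepThree.exponent_lt3`): if `Fform = (∑ Qᵢ w^i)/Wt · w^{-n}` is absolutely integrable on
the open polyhedral cell `Ω` above the pole plane, `(v₀, 0)` is adherent to `Ω`, no letter through
`v₀` with non-zero exponent is identically zero, and the numerator has real Taylor data `c` at
`(v₀, 0)` with a non-zero coefficient, then `n + E < ord c + 3`, `E` the order of the letter block
at `v₀` and `ord c` the order of the numerator at `(v₀, 0)`. -/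
theorem separateThree_lower {J m : ℕ} (g : Fin J → (Fin 2 → ℝ) × ℝ × ℝ) (κ : Fin m → Fin 2 → ℝ) (μ : Fin m → ℝ) (e : Fin m → ℕ) (N : ℕ) (q : ℕ → MvPolynomial (Fin 2) ℝ) (n : ℕ) (v₀ : Fin 2 → ℝ) (hcl : ((v₀, 0) : (Fin 2 → ℝ) × ℝ) ∈ closure (SepThree.Om3 g)) (hpos : ∀ p ∈ SepThree.Om3 g, 0 < p.2) (hint : MeasureTheory.IntegrableOn (SepThree.Fform κ μ e N q n) (SepThree.Om3 g)) (hnd : ∀ j, SepThree.lval κ μ j v₀ = 0 → e j ≠ 0 → κ j ≠ 0) {d : ℕ} (hNd : N ≤ d + 1) (c : SepThree.Coef d) (hc : ∀ (i : ℕ) (hi : i < N) (u : Fin 2 → ℝ), MvPolynomial.eval (v₀ + u) (q i) = SepTwo.pev₂ (c ⟨i, lt_of_lt_of_le hi hNd⟩) (u 0) (u 1)) (hc0 : ∀ i : Fin (d + 1), N ≤ (i : ℕ) → c i = 0) (h : (SepThree.nz c).Nonempty) : n + SepThree.Eord κ μ e v₀ < SepThree.ord c h + 3 := by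
  exact SepThree.exponent_lt3 g κ μ e N q n v₀ hcl hpos hint hnd hNd c hc hc0 h

end Summit.KontsevichZagierPeriods.ArrangementNormalForm.JanusBands
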